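import Literature.Geometry.Riemannian.BochnerIntegratedHessian
import Literature.Geometry.Riemannian.CalabiMinimalGeodesicCutLocus
import Literature.Geometry.Riemannian.DistSqDirectionalDatumAux
import HarnessLib

/-!
# The Hessian controls the deviation from linearity along geodesics

The pointwise core of the Cheeger–Colding "almost linearity along most segments" arguments
(Cheeger–Colding 1996, §6, proof of Thm. 6.62, and 2000, §1: the segment inequality applied to
`|Hess b|` bounds `∫_γ |Hess b|` for most minimal segments `γ`, along which `b` is then almost
affine): for `b ∈ C^∞(M)` and the unit-speed geodesic `γ(t) = exp_x(t u)`, `|u|_g = 1`, of a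
Riemannian manifold with complete Levi-Civita connection,

* `abs_deriv_comp_expMap_sub_le` — `|(b ∘ γ)'(t) − db_x(u)| ≤ ∫₀ᵗ |Hess b|(γ(s)) ds`,
* `abs_comp_expMap_sub_linear_le` — `|b(γ(t)) − b(x) − t db_x(u)| ≤ t ∫₀ᵗ |Hess b|(γ(s)) ds`,

`t ≥ 0`, where `|Hess b| = √(|Hess b|²_g)` (`(b∘γ)'' = Hess b(γ̇, γ̇)`,
`hasDerivAt_mvfderiv_velocity_of_isGeodesicOn`; `|Hess b(γ̇,γ̇)| ≤ |Hess b| |γ̇|²`,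
`apply_sq_le_normSq_mul`; mean value inequalities).

No definitions, no named facts (D-0026). Groundwork for `CheegerColding1997_sphereStability`.

## References

* J. Cheeger, T. H. Colding, Ann. of Math. 144 (1996) 189–237, §2 and §6. [CheegerColding1996]
* B. O'Neill, *Semi-Riemannian geometry* (1983), Ch. 3, Lemma 3.49. [ONeill1983]
-/

noncomputable section

open Bundle Set Function Filter Topology MeasureTheory
open scoped Manifold ContDiff ENNReal NNReal

namespace Literature.Geometry.Riemannian

open Literature.Geometry.Lorentzian
open Literature.Geometry.Lorentzian.PseudoRiemannianMetric

section Along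

variable {E : Type*} [NormedAddCommGroup E] [NormedSpace ℝ E] [FiniteDimensional ℝ E]
  [CompleteSpace E] {M : Type*} [TopologicalSpace M] [ChartedSpace E M] [IsManifold 𝓘(ℝ, E) ∞ M]
  [T2Space M]
  (g : PseudoRiemannianMetric 𝓘(ℝ, E) ∞ E (TangentSpace 𝓘(ℝ, E) : M → Type _)) [g.HasLeviCivita]
  [CovariantDerivative.ContMDiffCovariantDerivative g.leviCivita 1]
  [CovariantDerivative.ContMDiffCovariantDerivative g.leviCivita ∞]

omit [FiniteDimensional ℝ E] [CompleteSpace E] [IsManifold 𝓘(ℝ, E) ∞ M] [T2Space M] [g.HasLeviCivita]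
  [CovariantDerivative.ContMDiffCovariantDerivative g.leviCivita 1]
  [CovariantDerivative.ContMDiffCovariantDerivative g.leviCivita ∞] in
/-- **A one-variable Taylor estimate with an integral bound on the second derivative**: if
`f' ` is the derivative of `f` and `|f''| ≤ h` with `h` continuous on `[0, T]`, then for
`t ∈ [0, T]`: `|f'(t) − f'(0)| ≤ ∫₀ᵗ h` and `|f(t) − f(0) − t f'(0)| ≤ t ∫₀ᵗ h`. [folklore] -/
theorem abs_sub_linear_le_of_abs_deriv_two_le {f f' f'' h : ℝ → ℝ} {T : ℝ}
    (hf : ∀ t, HasDerivAt f (f' t) t) (hf' : ∀ t, HasDerivAt f' (f'' t) t)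
    (hh : Continuous h) (hbd : ∀ t ∈ Icc (0 : ℝ) T, |f'' t| ≤ h t) {t : ℝ} (ht : t ∈ Icc (0 : ℝ) T) :
    |f' t - f' 0| ≤ ∫ s in (0 : ℝ)..t, h s ∧ |f t - f 0 - t * f' 0| ≤ t * ∫ s in (0 : ℝ)..t, h s := by
  -- first derivative: two-sided comparison with `B(s) = ±f'(0) + ∫₀ˢ h`
  have hH : ∀ s, HasDerivAt (fun s ↦ ∫ σ in (0 : ℝ)..s, h σ) (h s) s := fun s ↦
    intervalIntegral.integral_hasDerivAt_right (hh.intervalIntegrable _ _)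
      hh.aestronglyMeasurable.stronglyMeasurableAtFilter hh.continuousAt
  have hfirst : ∀ s ∈ Icc (0 : ℝ) T, |f' s - f' 0| ≤ ∫ σ in (0 : ℝ)..s, h σ := by
    intro s hs
    have hup := image_le_of_deriv_right_le_deriv_boundary (f := f') (a := 0) (b := T)
      (fun σ _ ↦ (hf' σ).continuousAt.continuousWithinAt) (fun σ _ ↦ (hf' σ).hasDerivWithinAt)
      (B := fun σ ↦ f' 0 + ∫ τ in (0 : ℝ)..σ, h τ) (B' := h) (by simp)
      (fun σ _ ↦ ((hH σ).const_add (f' 0)).continuousAt.continuousWithinAt)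
      (fun σ _ ↦ ((hH σ).const_add (f' 0)).hasDerivWithinAt)
      (fun σ hσ ↦ (le_abs_self _).trans (hbd σ (Ico_subset_Icc_self hσ))) hs
    have hdown := image_le_of_deriv_right_le_deriv_boundary (f := fun σ ↦ -f' σ) (a := 0) (b := T)
      (fun σ _ ↦ (hf' σ).neg.continuousAt.continuousWithinAt) (fun σ _ ↦ (hf' σ).neg.hasDerivWithinAt)
      (B := fun σ ↦ -f' 0 + ∫ τ in (0 : ℝ)..σ, h τ) (B' := h) (by simp)
      (fun σ _ ↦ ((hH σ).const_add (-f' 0)).continuousAt.continuousWithinAt)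
      (fun σ _ ↦ ((hH σ).const_add (-f' 0)).hasDerivWithinAt)
      (fun σ hσ ↦ (neg_le_abs _).trans (hbd σ (Ico_subset_Icc_self hσ))) hs
    have hup' : f' s ≤ f' 0 + ∫ τ in (0 : ℝ)..s, h τ := hup
    have hdown' : -f' s ≤ -f' 0 + ∫ τ in (0 : ℝ)..s, h τ := hdown
    rw [abs_le]; constructor <;> linarith
  refine ⟨hfirst t ht, ?_⟩
  -- the function: `f(t) - f(0) - t f'(0) = ∫₀ᵗ (f' - f'(0))`
  have hc' : Continuous f' := continuous_iff_continuousAt.2 fun s ↦ (hf' s).continuousAt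
  have hI1 : ∫ s in (0 : ℝ)..t, f' s = f t - f 0 :=
    intervalIntegral.integral_eq_sub_of_hasDerivAt (fun s _ ↦ hf s) (hc'.intervalIntegrable _ _)
  have hI : ∫ s in (0 : ℝ)..t, (f' s - f' 0) = f t - f 0 - t * f' 0 := by
    rw [intervalIntegral.integral_sub (hc'.intervalIntegrable _ _) intervalIntegrable_const, hI1,
      intervalIntegral.integral_const, smul_eq_mul, sub_zero]
  have ht0 : 0 ≤ t := ht.1
  have hh0 : ∀ s ∈ Icc (0 : ℝ) T, 0 ≤ h s := fun s hs ↦ (abs_nonneg _).trans (hbd s hs)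
  have hHmono : ∀ s ∈ Icc (0 : ℝ) t, ∫ σ in (0 : ℝ)..s, h σ ≤ ∫ σ in (0 : ℝ)..t, h σ := by
    intro s hs
    refine intervalIntegral.integral_mono_interval le_rfl hs.1 hs.2 ?_ (hh.intervalIntegrable _ _)
    filter_upwards [ae_restrict_mem measurableSet_Ioc] with σ hσ
    exact hh0 σ ⟨hσ.1.le, hσ.2.trans ht.2⟩
  rw [← hI]
  calc |∫ s in (0 : ℝ)..t, (f' s - f' 0)| ≤ ∫ s in (0 : ℝ)..t, |f' s - f' 0| :=
        intervalIntegral.abs_integral_le_integral_abs ht0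
    _ ≤ ∫ s in (0 : ℝ)..t, (∫ σ in (0 : ℝ)..t, h σ) := by
        refine intervalIntegral.integral_mono_on ht0 ((hc'.sub continuous_const).abs.intervalIntegrable _ _)
          intervalIntegrable_const fun s hs ↦ ?_
        exact (hfirst s ⟨hs.1, hs.2.trans ht.2⟩).trans (hHmono s hs)
    _ = t * ∫ σ in (0 : ℝ)..t, h σ := by
        rw [intervalIntegral.integral_const, smul_eq_mul, sub_zero]

/-- **The Hessian controls the first derivative along a unit-speed geodesic**: for `b ∈ C^∞(M)`,
`|u|_g = 1` and `t ≥ 0`, `|(b ∘ γ)'(t) − db_x(u)| ≤ ∫₀ᵗ √(|Hess b|²_g(γ(s))) ds`,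
`γ(s) = exp_x(s u)`. [cite: CheegerColding1996, §6] [cite: ONeill1983, Ch. 3, Lemma 3.49] -/
theorem abs_mvfderiv_velocity_sub_le (hg : g.IsRiemannian) (hc : IsGeodesicallyComplete g.leviCivita)
    {b : M → ℝ} (hb : ContMDiff 𝓘(ℝ, E) 𝓘(ℝ, ℝ) ∞ b) (x : M) (u : TangentSpace 𝓘(ℝ, E) x)
    (hu : g.val x u u = 1) {t : ℝ} (ht : 0 ≤ t) :
    |mvfderiv 𝓘(ℝ, E) b (expMap g.leviCivita x (t • u))
        (velocity 𝓘(ℝ, E) (fun s ↦ expMap g.leviCivita x (s • u)) t) - mvfderiv 𝓘(ℝ, E) b x u| ≤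
      ∫ s in (0 : ℝ)..t, Real.sqrt (g.normSq (expMap g.leviCivita x (s • u))
        (g.hessian b (expMap g.leviCivita x (s • u)))) ∧
    |b (expMap g.leviCivita x (t • u)) - b x - t * mvfderiv 𝓘(ℝ, E) b x u| ≤
      t * ∫ s in (0 : ℝ)..t, Real.sqrt (g.normSq (expMap g.leviCivita x (s • u))
        (g.hessian b (expMap g.leviCivita x (s • u)))) := by
  haveI : Fact ((1 : ℕ∞ω) ≤ (∞ : ℕ∞ω)) := ⟨by exact_mod_cast le_top⟩
  set γ : ℝ → M := fun s ↦ expMap g.leviCivita x (s • u) with hγ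
  obtain ⟨hγs, hγ0, hspeed⟩ := contMDiff_and_unit_speed_expMap_smul g hc x u hu
  have hgeo : IsGeodesic g.leviCivita γ := isGeodesic_expMap_smul_of_isGeodesicallyComplete hc x u
  -- `f = b ∘ γ`, `f' = db(γ̇)`, `f'' = Hess b(γ̇, γ̇)`
  set f : ℝ → ℝ := fun s ↦ b (γ s) with hf
  set f' : ℝ → ℝ := fun s ↦ mvfderiv 𝓘(ℝ, E) b (γ s) (velocity 𝓘(ℝ, E) γ s) with hf'
  set f'' : ℝ → ℝ := fun s ↦ g.hessian b (γ s) (velocity 𝓘(ℝ, E) γ s) (velocity 𝓘(ℝ, E) γ s) with hf''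
  have hdf : ∀ s, HasDerivAt f (f' s) s := fun s ↦
    hasDerivAt_comp_curve_mvfderiv ((hb (γ s)).mdifferentiableAt (by simp))
      ((hγs s).mdifferentiableAt (by simp))
  have hdf' : ∀ s, HasDerivAt f' (f'' s) s := fun s ↦
    g.hasDerivAt_mvfderiv_velocity_of_isGeodesicOn (hgeo.isGeodesicOn univ) (mem_univ s)
      ((hb (γ s)).of_le (by norm_cast))
  -- `|f''| ≤ h = √|Hess b|²` (Cauchy–Schwarz with `|γ̇| = 1`)
  set h : ℝ → ℝ := fun s ↦ Real.sqrt (g.normSq (γ s) (g.hessian b (γ s))) with hh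
  have hhc : Continuous h := by
    refine Real.continuous_sqrt.comp ?_
    exact (contMDiff_normSq_hessian g hb).continuous.comp hγs.continuous
  have hbd : ∀ s ∈ Icc (0 : ℝ) t, |f'' s| ≤ h s := by
    intro s _
    have hCS := apply_sq_le_normSq_mul g hg (γ s) (g.hessian b (γ s)) (velocity 𝓘(ℝ, E) γ s)
      (velocity 𝓘(ℝ, E) γ s)
    rw [hspeed s, mul_one, mul_one] at hCS
    have hN0 : 0 ≤ g.normSq (γ s) (g.hessian b (γ s)) := g.normSq_nonneg (γ s) hg _
    rw [← Real.sqrt_sq_eq_abs]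
    exact Real.sqrt_le_sqrt hCS
  have key := abs_sub_linear_le_of_abs_deriv_two_le hdf hdf' hhc hbd ⟨ht, le_rfl⟩
  -- `f' 0 = db_x(u)` (`γ(0) = x`, `γ̇(0) = u`) and `f 0 = b x`
  have hvel : velocity 𝓘(ℝ, E) γ 0 = u := velocity_expMap_smul_zero x u
  replace hγ0 : γ 0 = x := by simp only [hγ]; exact hγ0
  have hf'0 : f' 0 = mvfderiv 𝓘(ℝ, E) b x u := by
    have h1 : HasDerivAt f (mvfderiv 𝓘(ℝ, E) b x u) 0 := by
      have hb' : MDifferentiableAt 𝓘(ℝ, E) 𝓘(ℝ, ℝ) b (γ 0) := by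
        rw [hγ0]; exact (hb x).mdifferentiableAt (by simp)
      have h := hasDerivAt_comp_curve_mvfderiv hb' ((hγs 0).mdifferentiableAt (by simp))
      rw [hvel] at h
      have heq : mvfderiv 𝓘(ℝ, E) b (γ 0) u = mvfderiv 𝓘(ℝ, E) b x u := by rw [hγ0]
      rwa [heq] at h
    exact (hdf 0).unique h1
  have hf0 : f 0 = b x := by simp only [hf]; rw [hγ0]
  rw [hf'0, hf0] at key
  exact key

end Along

end Literature.Geometry.Riemannian

end
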